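import Literature.NumberTheory.DiophantineGeometry.AbelianVarietyOrdinaryReductionFiltrationProofs
import Mathlib.LinearAlgebra.Dual.Lemmas
import HarnessLib

/-!
# The ordinary filtration of `V_p B` without lifting torsion points

The assembly `exists_ordinaryFiltration_of_reduction`
(`AbelianVarietyOrdinaryReductionFiltrationProofs.lean`) of the named fact
`ordinaryReduction_tateModule_filtration` (Greenberg 1991, §2) asks that the reduction map
`red : B(K̄) → Ā` be **onto on `pⁿ`-torsion** (`hsurj`), used only to compute
`dim ker V_p(red) = 2g - g`.  This file removes that hypothesis: given the isotropy of
`W = ker V_p(red)` for a non-degenerate form on `V_p B` (needed anyway for the inertia clause),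

* `dim W ≥ 2g - g`, by rank–nullity for `V_p(red) : V_p B → V_p Ā` with `dim V_p Ā = g`
  (`RationalTateModule.finrank_le_finrank_ker_baseChange_map_add`: counts on the target only), and
* `dim W ≤ g`, because an isotropic subspace of a `2g`-dimensional space carrying a
  non-degenerate bilinear form has dimension `≤ g` (`finrank_add_finrank_le_of_isotropic`:
  `V → W^*`, `x ↦ e(x, ·)|_W` is onto with `W` in its kernel).

Hence `exists_ordinaryFiltration_of_reduction_of_isotropic` (no `hsurj`) and the corresponding
reduction `ordinaryReduction_tateModule_filtration_of_reductionData'` of the named fact: what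
remains is a reduction datum (equivariant, inertia-trivial, ordinary counts — constructed in
`AbelianSchemeModelReduction.lean`), a Weil pairing on `V_p B`, and the isotropy of the kernel of
reduction (Cartier duality; Shatz 1986, §6–§7).

## References
* [Greenberg1991] R. Greenberg, *Iwasawa theory for motives*, §2 (p. 214).
* S. S. Shatz, *Group schemes, formal groups, and p-divisible groups*, in Cornell–Silverman (1986),
  §6–§7.
-/

noncomputable section

open scoped AddSubgroup TensorProduct NumberField
open Field IsDedekindDomain
open Literature.NumberTheory.GaloisRepresentations Literature.NumberTheory.EllipticCurves
open Literature.AlgebraicGeometry.Motives (AbelianVariety)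

namespace Literature.NumberTheory.DiophantineGeometry

/-! ### Linear algebra: isotropic subspaces have at most half the dimension -/

/-- **An isotropic subspace has dimension at most half**: if `e` is a left-separating bilinear form
on a finite-dimensional space `V` and `e(x, y) = 0` for all `x, y ∈ W`, then
`2 dim W ≤ dim V` (the map `V → W^*`, `x ↦ e(x,·)|_W`, is onto — `e : V ≃ V^*` and restriction
`V^* → W^*` is onto — and `W` lies in its kernel).  Standard (e.g. Milnor–Husemoller, *Symmetric
Bilinear Forms*, I §3). [folklore] -/
theorem finrank_add_finrank_le_of_isotropic {F V : Type*} [Field F] [AddCommGroup V] [Module F V]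
    [FiniteDimensional F V] (e : LinearMap.BilinForm F V) (he : e.SeparatingLeft)
    (W : Submodule F V) (hW : ∀ x ∈ W, ∀ y ∈ W, e x y = 0) :
    Module.finrank F W + Module.finrank F W ≤ Module.finrank F V := by
  let φ : V →ₗ[F] Module.Dual F W := W.dualRestrict.comp e
  have hinj : Function.Injective (e : V →ₗ[F] Module.Dual F V) :=
    LinearMap.ker_eq_bot.mp (LinearMap.separatingLeft_iff_ker_eq_bot.mp he)
  have hsurjE : Function.Surjective (e : V →ₗ[F] Module.Dual F V) :=
    (LinearMap.injective_iff_surjective_of_finrank_eq_finrank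
      (Subspace.dual_finrank_eq (K := F) (V := V)).symm).mp hinj
  have hφ : Function.Surjective φ := (Subspace.dualRestrict_surjective (W := W)).comp hsurjE
  have hker : W ≤ LinearMap.ker φ := fun x hx ↦ by
    rw [LinearMap.mem_ker]
    ext ⟨y, hy⟩
    exact hW x hx y hy
  have hrank := LinearMap.finrank_range_add_finrank_ker φ
  rw [LinearMap.range_eq_top.mpr hφ, finrank_top, Subspace.dual_finrank_eq] at hrank
  have hmono := Submodule.finrank_mono hker
  omega

/-! ### Rank bound for the kernel of `V_p f` from torsion counts on the target -/

/-- `dim_{ℚ_p} V_p X = d` if `#X[pⁿ] = p^{dn}` for all `n` (`T_p X ≅ ℤ_p^d`, tree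
`TateModule.finrank_eq_of_card_torsionBy`, and `Module.finrank_baseChange`). [folklore] -/
theorem RationalTateModule.finrank_baseChange_of_card_torsionBy {X : Type*} [AddCommGroup X]
    (p : ℕ) [Fact p.Prime] {d : ℕ} (h : ∀ n, Nat.card (X[(p ^ n : ℕ)]) = p ^ (d * n)) :
    Module.finrank ℚ_[p] (ℚ_[p] ⊗[ℤ_[p]] TateModule X p) = d := by
  haveI := TateModule.free_of_card_torsionBy_rank h
  rw [Module.finrank_baseChange, TateModule.finrank_eq_of_card_torsionBy h]

/-- **`dim V_p A ≤ dim ker V_p(f) + b`** for `f : A → B` with `#B[pⁿ] = p^{bn}` (rank–nullity: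
the image of `V_p(f)` lies in the `b`-dimensional `V_p B`); no surjectivity on torsion is needed.
[folklore] -/
theorem RationalTateModule.finrank_le_finrank_ker_baseChange_map_add {A B : Type*} [AddCommGroup A]
    [AddCommGroup B] (p : ℕ) [Fact p.Prime] (f : A →+ B) {b : ℕ}
    (hB : ∀ n, Nat.card (B[(p ^ n : ℕ)]) = p ^ (b * n)) :
    Module.finrank ℚ_[p] (ℚ_[p] ⊗[ℤ_[p]] TateModule A p) ≤
      Module.finrank ℚ_[p] (LinearMap.ker ((TateModule.map p f).baseChange ℚ_[p])) + b := by
  haveI := TateModule.free_of_card_torsionBy_rank hB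
  haveI := TateModule.finite_of_card_torsionBy_rank hB
  by_cases hfin : FiniteDimensional ℚ_[p] (ℚ_[p] ⊗[ℤ_[p]] TateModule A p)
  swap
  · rw [Module.finrank_of_not_finite hfin]; exact Nat.zero_le _
  have hrank := LinearMap.finrank_range_add_finrank_ker ((TateModule.map p f).baseChange ℚ_[p])
  have hrange : Module.finrank ℚ_[p] (LinearMap.range ((TateModule.map p f).baseChange ℚ_[p])) ≤ b := by
    rw [← RationalTateModule.finrank_baseChange_of_card_torsionBy p hB]
    exact Submodule.finrank_le _
  omega

/-! ### The assembly without `hsurj` -/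

section Assembly

variable {K : Type} [Field K] [NumberField K]
variable (B : AbelianVariety K) (v : HeightOneSpectrum (𝓞 K)) (p : ℕ) [Fact p.Prime]
  {Ā : Type} [AddCommGroup Ā]
  [DistribMulAction (absoluteGaloisGroup (v.adicCompletion K)) Ā]

/-- **The ordinary filtration of `V_p B`, assembled without lifting torsion.**  As
`exists_ordinaryFiltration_of_reduction`, but without the hypothesis that `red` is onto on
`pⁿ`-torsion: `dim W ≥ g` by rank–nullity (`dim V_p B = 2g`, `dim V_p Ā = g`) and `dim W ≤ g`
because `W = ker V_p(red)` is isotropic for the non-degenerate `e` on the `2g`-dimensional `V_p B`.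
[cite: Greenberg1991, §2 (p. 214)] -/
theorem exists_ordinaryFiltration_of_reduction_of_isotropic (red : B.geomPoints →+ Ā)
    (hred : ∀ (τ : absoluteGaloisGroup (v.adicCompletion K)) (P : B.geomPoints),
      red (absGaloisRestrict K (v.adicCompletion K) τ • P) = τ • red P)
    (hI : ∀ τ ∈ absInertia (v.adicCompletion K), ∀ y : Ā, τ • y = y)
    (hcount : ∀ n, Nat.card (Ā[(p ^ n : ℕ)]) = p ^ (B.dim * n))
    (e : LinearMap.BilinForm ℚ_[p] (B.rationalTateModule p)) (he : e.Nondegenerate)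
    (heq : ∀ (g : absoluteGaloisGroup K) (x y : B.rationalTateModule p),
      e (B.rationalTateRep p g x) (B.rationalTateRep p g y) =
        (((GaloisRep.cyclotomicCharacter K p g : ℤ_[p]ˣ) : ℤ_[p]) : ℚ_[p]) * e x y)
    (hiso : ∀ x y : B.rationalTateModule p,
      (TateModule.map p red).baseChange ℚ_[p] x = 0 →
        (TateModule.map p red).baseChange ℚ_[p] y = 0 → e x y = 0) :
    ∃ W : Submodule ℚ_[p] (B.rationalTateModule p),
      Module.finrank ℚ_[p] W = B.dim ∧
      (∀ (τ : absoluteGaloisGroup (v.adicCompletion K)), ∀ w ∈ W,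
          B.rationalTateRep p (absGaloisRestrict K (v.adicCompletion K) τ) w ∈ W) ∧
      (∀ τ ∈ absInertia (v.adicCompletion K), ∀ w ∈ W,
          B.rationalTateRep p (absGaloisRestrict K (v.adicCompletion K) τ) w =
            (((GaloisRep.cyclotomicCharacter (v.adicCompletion K) p τ : ℤ_[p]ˣ) : ℤ_[p]) :
              ℚ_[p]) • w) ∧
      (∀ τ ∈ absInertia (v.adicCompletion K), ∀ x : B.rationalTateModule p,
          B.rationalTateRep p (absGaloisRestrict K (v.adicCompletion K) τ) x - x ∈ W) := by
  haveI : NeZero (p : K) := ⟨Nat.cast_ne_zero.mpr (Fact.out : p.Prime).ne_zero⟩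
  -- `W = F¹ = ker (V_p red)`
  let W : Submodule ℚ_[p] (B.rationalTateModule p) :=
    LinearMap.ker ((TateModule.map p red).baseChange ℚ_[p])
  have hW : ∀ x : B.rationalTateModule p,
      x ∈ W ↔ (TateModule.map p red).baseChange ℚ_[p] x = 0 := fun x ↦ LinearMap.mem_ker
  -- inertia moves everything into `W` (clause 4)
  have h4 : ∀ τ ∈ absInertia (v.adicCompletion K), ∀ x : B.rationalTateModule p,
      B.rationalTateRep p (absGaloisRestrict K (v.adicCompletion K) τ) x - x ∈ W :=
    fun τ hτ x ↦ RationalTateModule.baseChange_tateRepresentation_sub_mem_ker red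
      (absGaloisRestrict K (v.adicCompletion K) τ) (fun P ↦ by rw [hred, hI τ hτ]) x
  refine ⟨W, ?_, ?_, ?_, h4⟩
  · -- clause 1: `g ≤ dim W ≤ g`
    have h2g : Module.finrank ℚ_[p] (ℚ_[p] ⊗[ℤ_[p]] TateModule B.geomPoints p) = 2 * B.dim :=
      RationalTateModule.finrank_baseChange_of_card_torsionBy p (natCard_geomTorsion_pow B p)
    have hge := RationalTateModule.finrank_le_finrank_ker_baseChange_map_add p red hcount
    rw [h2g] at hge
    haveI := TateModule.finite_of_card_torsionBy_rank (natCard_geomTorsion_pow B p)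
    haveI : Module.Finite ℚ_[p] (B.rationalTateModule p) :=
      inferInstanceAs (Module.Finite ℚ_[p] (ℚ_[p] ⊗[ℤ_[p]] TateModule B.geomPoints p))
    have hle := finrank_add_finrank_le_of_isotropic e he.1 W
      (fun x hx y hy ↦ hiso x y ((hW x).mp hx) ((hW y).mp hy))
    change Module.finrank ℚ_[p] W + Module.finrank ℚ_[p] W ≤
      Module.finrank ℚ_[p] (ℚ_[p] ⊗[ℤ_[p]] TateModule B.geomPoints p) at hle
    rw [h2g] at hle
    change 2 * B.dim ≤ Module.finrank ℚ_[p] W + B.dim at hge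
    omega
  · -- clause 2: stability under `res (Γ_{K_v})`
    intro τ w hw
    rw [hW] at hw ⊢
    change (TateModule.map p red).baseChange ℚ_[p]
      ((tateRepresentation (absoluteGaloisGroup K) B.geomPoints p
        (absGaloisRestrict K (v.adicCompletion K) τ)).baseChange ℚ_[p] w) = 0
    rw [baseChange_map_red_smul B v p red hred, hw, map_zero]
  · -- clause 3: inertia acts on `W` by `χ_p(res τ) = χ_p(τ)`
    intro τ hτ w hw
    rw [← cyclotomicCharacter_absGaloisRestrict K (v.adicCompletion K) p τ]
    exact Literature.LinearAlgebra.QuadraticForm.apply_eq_smul_of_forall_sub_mem_of_isotropic e he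
      (B.rationalTateRep p (absGaloisRestrict K (v.adicCompletion K) τ)) _
      (heq (absGaloisRestrict K (v.adicCompletion K) τ)) W
      (fun x hx y hy ↦ hiso x y ((hW x).mp hx) ((hW y).mp hy)) (h4 τ hτ) w hw

end Assembly

/-- **What remains of the named fact (no torsion lifting).**
`ordinaryReduction_tateModule_filtration` follows as soon as every abelian variety `B` with good
ordinary reduction at `v ∣ p` is given: a reduction datum at `v` (equivariant along `res`,
inertia-trivial, with the ordinary torsion counts — constructed from any abelian-scheme model in
`AbelianSchemeModelReduction.lean`), a non-degenerate `χ_p`-similitude form on `V_p B` (the Weil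
pairing, Milne 1986 §16) and the isotropy of `ker V_p(red)` (Shatz 1986, §6).
[cite: Greenberg1991, §2 (p. 214)] -/
theorem ordinaryReduction_tateModule_filtration_of_reductionData'
    (hdata : ∀ {K : Type} [Field K] [NumberField K] (B : AbelianVariety K)
      (v : HeightOneSpectrum (𝓞 K)) (p : ℕ) [Fact p.Prime],
      ((p : ℕ) : 𝓞 K) ∈ v.asIdeal → B.HasGoodOrdinaryReductionAt v →
      ∃ (Ā : Type) (_ : AddCommGroup Ā)
        (_ : DistribMulAction (absoluteGaloisGroup (v.adicCompletion K)) Ā)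
        (red : B.geomPoints →+ Ā) (e : LinearMap.BilinForm ℚ_[p] (B.rationalTateModule p)),
        (∀ (τ : absoluteGaloisGroup (v.adicCompletion K)) (P : B.geomPoints),
            red (absGaloisRestrict K (v.adicCompletion K) τ • P) = τ • red P) ∧
        (∀ τ ∈ absInertia (v.adicCompletion K), ∀ y : Ā, τ • y = y) ∧
        (∀ n, Nat.card (Ā[(p ^ n : ℕ)]) = p ^ (B.dim * n)) ∧
        e.Nondegenerate ∧
        (∀ (g : absoluteGaloisGroup K) (x y : B.rationalTateModule p),
            e (B.rationalTateRep p g x) (B.rationalTateRep p g y) =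
              (((GaloisRep.cyclotomicCharacter K p g : ℤ_[p]ˣ) : ℤ_[p]) : ℚ_[p]) * e x y) ∧
        (∀ x y : B.rationalTateModule p,
            (TateModule.map p red).baseChange ℚ_[p] x = 0 →
              (TateModule.map p red).baseChange ℚ_[p] y = 0 → e x y = 0)) :
    ordinaryReduction_tateModule_filtration := by
  intro K _ _ B v p _ hpv hord
  obtain ⟨Ā, _, _, red, e, hred, hI, hcount, he, heq, hiso⟩ := hdata B v p hpv hord
  exact exists_ordinaryFiltration_of_reduction_of_isotropic B v p red hred hI hcount e he heq hiso

end Literature.NumberTheory.DiophantineGeometry
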